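import Literature.NumberTheory.LFunctions.WeilExplicitContinuous
import HarnessLib

/-!
# Mollification preserves local sup bounds and shifts envelopes by the radius (PR/FIN input for D6 on the mollified tail)

WEIL column (LADDER-RH, W-P(P2); tier-1 `ThetaCertificateSound`, THETA-ASSIGN §6 Step 5). handoff-prove-2's abstract prime-side
bound `ThetaPrime.norm_weilPrimeTerm_le_of_oddTail` takes ANY tail `T` with `T = 0` on `(x₁, ∞)` and `‖T u‖ ≤ E·e^{κ(u − x₁)}` on
`(−∞, x₁]`; the mollified tail `T ⋆ moll_k` is such a tail again, with `x₁ ↦ x₁ + r_k`, `E ↦ E·e^{2κ r_k}` (`r_k = 1/(k+1)`):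
* `norm_weilConv_moll_le_of_local_bound`: if `‖T v‖ ≤ B` on the ball `|v − u| ≤ r_k` then `‖(T ⋆ moll_k)(u)‖ ≤ B`;
* `weilConv_moll_eq_zero_of_vanish`: `T = 0` on `(b, ∞)` ⇒ `T ⋆ moll_k = 0` on `(b + r_k, ∞)`;
* `norm_weilConv_moll_le_envelope`: the exponential envelope statement above.
RH-free; nothing here bears on the truth of RH.
-/

set_option linter.dupNamespace false

noncomputable section

open MeasureTheory Set Complex Filter
open Literature.NumberTheory.LFunctions Literature.NumberTheory.LFunctions.WeilContinuous

namespace Summit.RiemannHypothesis.RiemannHypothesis.Theorems.WeilColumn.ThetaMellin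

/-- Outside the radius the mollifier vanishes: `|x| ≥ 1/(k+1) ⇒ moll_k x = 0`. [folklore] -/
theorem moll_eq_zero_of_le {k : ℕ} {x : ℝ} (hx : 1 / ((k : ℝ) + 1) ≤ |x|) : moll k x = 0 :=
  moll_eq_zero (by rw [bump_rOut]; exact hx)

/-- **Local sup bound survives mollification**: if `‖T v‖ ≤ B` whenever `|u − v| ≤ 1/(k+1)`, then `‖(T ⋆ moll_k)(u)‖ ≤ B`
(no regularity of `T` needed: the bound is against an integrable majorant). [folklore] -/
theorem norm_weilConv_moll_le_of_local_bound {T : ℝ → ℂ} (k : ℕ) {u B : ℝ}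
    (hB : ∀ v, |u - v| ≤ 1 / ((k : ℝ) + 1) → ‖T v‖ ≤ B) : ‖weilConv T (moll k) u‖ ≤ B := by
  have hB0 : 0 ≤ B := (norm_nonneg _).trans (hB u (by simp; positivity))
  rw [weilConv_apply]
  -- pointwise: ‖T v · moll(u − v)‖ ≤ B · moll(u − v) (as a real weight)
  have hpt : ∀ v, ‖T v * moll k (u - v)‖ ≤ B * (bump k).normed volume (u - v) := by
    intro v
    rw [norm_mul, norm_moll]
    by_cases hv : |u - v| ≤ 1 / ((k : ℝ) + 1)
    · exact mul_le_mul_of_nonneg_right (hB v hv) ((bump k).nonneg_normed _)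
    · have : moll k (u - v) = 0 := moll_eq_zero_of_le (le_of_lt (not_le.mp hv))
      have h0 : (bump k).normed volume (u - v) = 0 := by
        have hn := norm_moll k (u - v); rw [this, norm_zero] at hn; exact hn.symm
      rw [h0]; simp
  have hint : Integrable fun v => B * (bump k).normed volume (u - v) :=
    ((bump k).integrable_normed.comp_sub_left u).const_mul B
  calc ‖∫ v, T v * moll k (u - v)‖ ≤ ∫ v, ‖T v * moll k (u - v)‖ := norm_integral_le_integral_norm _
    _ ≤ ∫ v, B * (bump k).normed volume (u - v) :=
        integral_mono_of_nonneg (Eventually.of_forall fun v => norm_nonneg _) hint (Eventually.of_forall hpt)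
    _ = B := by
        rw [integral_const_mul, integral_sub_left_eq_self (fun v => (bump k).normed volume v) volume u,
          (bump k).integral_normed, mul_one]

/-- `T = 0` on `(b, ∞)` ⇒ `(T ⋆ moll_k)(u) = 0` for `u > b + 1/(k+1)`. [folklore] -/
theorem weilConv_moll_eq_zero_of_vanish {T : ℝ → ℂ} (k : ℕ) {b u : ℝ} (hT0 : ∀ v, b < v → T v = 0)
    (hu : b + 1 / ((k : ℝ) + 1) < u) : weilConv T (moll k) u = 0 := by
  rw [weilConv_apply]
  refine (integral_congr_ae (Eventually.of_forall fun v => ?_)).trans (integral_zero _ _)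
  by_cases hv : b < v
  · rw [hT0 v hv, zero_mul]
  · have hv' : v ≤ b := not_lt.mp hv
    have hr : (0 : ℝ) < 1 / ((k : ℝ) + 1) := by positivity
    have : 1 / ((k : ℝ) + 1) ≤ |u - v| := by
      rw [abs_of_nonneg (by linarith)]; linarith
    rw [moll_eq_zero_of_le this, mul_zero]

/-- **The mollified tail has the shifted envelope**: if `T = 0` on `(x₁, ∞)` and `‖T v‖ ≤ E·e^{κ(v − x₁)}` on `(−∞, x₁]`
(`κ ≥ 0`, `E ≥ 0`), then with `r = 1/(k+1)`: `‖(T ⋆ moll_k)(u)‖ ≤ (E·e^{2κr})·e^{κ(u − (x₁ + r))}` for EVERY `u` (and `= 0` beyond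
`x₁ + r` by `weilConv_moll_eq_zero_of_vanish`). [folklore] -/
theorem norm_weilConv_moll_le_envelope {T : ℝ → ℂ} (k : ℕ) {x₁ E κ : ℝ} (hκ : 0 ≤ κ) (hE : 0 ≤ E)
    (hT0 : ∀ v, x₁ < v → T v = 0) (hTE : ∀ v, v ≤ x₁ → ‖T v‖ ≤ E * Real.exp (κ * (v - x₁))) (u : ℝ) :
    ‖weilConv T (moll k) u‖ ≤ (E * Real.exp (2 * κ * (1 / ((k : ℝ) + 1)))) * Real.exp (κ * (u - (x₁ + 1 / ((k : ℝ) + 1)))) := by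
  set r : ℝ := 1 / ((k : ℝ) + 1) with hr
  have hr0 : 0 < r := by rw [hr]; positivity
  refine norm_weilConv_moll_le_of_local_bound k fun v hv => ?_
  -- on the ball: either v > x₁ (T v = 0) or the envelope at v ≤ u + r
  by_cases hvx : x₁ < v
  · rw [hT0 v hvx, norm_zero]; positivity
  · refine (hTE v (not_lt.mp hvx)).trans ?_
    rw [mul_assoc, ← Real.exp_add]
    refine mul_le_mul_of_nonneg_left (Real.exp_le_exp.mpr ?_) hE
    have : v ≤ u + r := by have := (abs_le.mp hv).1; linarith
    nlinarith

end Summit.RiemannHypothesis.RiemannHypothesis.Theorems.WeilColumn.ThetaMellin
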